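import Summits.CriticalPhenomena.PercolationContinuityZ3.Theorems.Transplant.KNCellsStepsPin
import Summits.CriticalPhenomena.PercolationContinuityZ3.Theorems.Transplant.KNLevelsDefs
import HarnessLib

/-!
# F8 (generic), part 4g — the weightings of (30) and of (I1) are SUBBOX weightings (KN p. 17) on every part of `E_{v,x}` avoiding the revealed
# region, finitely supported on `E_i ∪ E_{w,v} ∪ E_{v,x}`: the hypotheses `LHyp.sub` / `LHyp.fin` of the target property over levels
# (`KNLevels.TargetProperty`, stmt's F7) for the instances' level data (design F8-DESIGN.md §5, inputs (I1)/(I2))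

builds on p205010 (kernel theorem, internal audit signed; external expert review pending) — nothing in this file uses p205010.
Lane `prim-bschramm`, seat `prim-bschramm-p2` (task F8 Steps-over-cells); helper file (`--supports stmt-CriticalPhenomena-4575`).

KN (p. 31): "`D = E_{v,x} ∪ Q_v` … is a subbox of `Ω`": the weighting of (30) — the graph weighting pinned on the recorded pattern of
`E_i ∪ E_{w,v} ∪ H^j` and restricted to `E_i ∪ E_{w,v} ∪ E_{v,x}` — gives the graph weights to every pair touching a set `Dd ⊆ E_i ∪ E_{w,v} ∪ E_{v,x}`
disjoint from `E_i ∪ E_{w,v} ∪ H^j`, and weight `0` to pairs leaving the region.  The same for the (I1) weighting `Wpin` (pinned on the edges of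
`E_i ∪ E_{w,v}`) and sets disjoint from `E_i ∪ E_{w,v}`.
* `Wt_apply_of_not_mem_wireSet`, `Wt_apply_of_not_mem_Fj`, **`finSupp_Wt`**, **`isSubbox_Wt`**;
* **`finSupp_Wpin`**, **`isSubbox_Wpin`**.
[cite: KozmaNitzan2024, §4 p. 17 (subbox), p. 31 (D is a subbox of Ω) — the ℤ^d model] [cite: GrimmettPercolation1999, §7.2]
-/

noncomputable section

open MeasureTheory ProbabilityTheory
open scoped ENNReal Classical

namespace Summit.CriticalPhenomena.PercolationContinuityZ3.Theorems

namespace Transplant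

namespace KNCells

open Literature.Probability.Percolation Literature.Probability.LatticeModels SimpleGraph GadgetSystem ProbeHistory HSiteScheme Contour

variable {V : Type*} [DecidableEq V]

namespace KSchA

variable {A : Type*} {G : SimpleGraph V} [G.LocallyFinite] {S : KSchA V A}
variable {h : ProbeHistory V} {e : Site 2 × MDir} {a a' : A} {du : MDir} {j : ℕ} {o P : Finset (Sym2 V)}

/-! ## The weighting of (30) -/

/-- `Wt` vanishes off the pairs of `E_i ∪ E_{w,v} ∪ E_{v,x}`. [folklore] -/
theorem Wt_apply_of_not_mem_wireSet {x : Sym2 V} (hx : x ∉ wireSet (↑(S.Sx G h e a a' du) : Set V)) :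
    S.Wt G h e a a' du j o x = 0 := by
  unfold Wt
  exact restrW_apply_of_not_mem _ hx

/-- **Off the conditioned edges of level `j`, `Wt` is the graph weighting** on the pairs of the region. [cite: KozmaNitzan2024, §4 p. 30 ((30))] -/
theorem Wt_apply_of_not_mem_Fj {x : Sym2 V} (hx : x ∈ wireSet (↑(S.Sx G h e a a' du) : Set V)) (hxj : x ∉ S.Fj G h e a a' du j) :
    S.Wt G h e a a' du j o x = KNLevels.lattW G S.p x := by
  unfold Wt
  rw [restrW_apply_of_mem _ hx, pinW_apply_of_not_mem _ _ (fun h' => hxj (Finset.mem_coe.1 h'))]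

/-- A pair with an endpoint outside `E_i ∪ E_{w,v} ∪ H^j` is not a conditioned edge of level `j`. [folklore] -/
theorem not_mem_Fj_of_not_mem {y z : V} (hy : y ∉ S.Vx G h ∪ S.Γ.Ewv a e.1 e.2 ∪ S.Γ.Stub a' (tgt e) du j) :
    s(y, z) ∉ S.Fj G h e a a' du j := by
  rw [Fj, mem_edgesIn_iff]
  exact fun h' => hy (h'.2 y (Sym2.mem_mk_left _ _))

omit [DecidableEq V] in
/-- A restricted weighting is finitely supported on the region. [folklore] -/
theorem finSupp_restrW [DecidableEq V] (Sf : Finset V) (w : Sym2 V → unitInterval) : KNLevels.FinSupp (restrW (↑Sf : Set V) w) Sf := by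
  refine ⟨fun x hx => restrW_apply_of_not_mem _ fun hxS => ?_⟩
  obtain ⟨y, hy, hyS⟩ := hx
  exact hyS (Finset.mem_coe.1 (hxS.1 y hy))

/-- **`Wt` is finitely supported on `E_i ∪ E_{w,v} ∪ E_{v,x}`.** [cite: KozmaNitzan2024, §4 p. 28 (Ω)] -/
theorem finSupp_Wt : KNLevels.FinSupp (S.Wt G h e a a' du j o) (S.Sx G h e a a' du) := by
  unfold Wt; exact finSupp_restrW _ _

/-- **`Wt` is a subbox weighting on every `Dd ⊆ E_i ∪ E_{w,v} ∪ E_{v,x}` disjoint from `E_i ∪ E_{w,v} ∪ H^j`** (KN: `D = E_{v,x} ∪ Q_v` beyond the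
revealed levels is a subbox of `Ω`). [cite: KozmaNitzan2024, §4 p. 31 (D is a subbox of Ω)] -/
theorem isSubbox_Wt {Dd : Finset V} (hD : Dd ⊆ S.Sx G h e a a' du)
    (hdis : Disjoint Dd (S.Vx G h ∪ S.Γ.Ewv a e.1 e.2 ∪ S.Γ.Stub a' (tgt e) du j)) :
    KNLevels.IsSubbox G (S.Wt G h e a a' du j o) S.p Dd := by
  have hfresh : ∀ u ∈ Dd, ∀ z, s(u, z) ∉ S.Fj G h e a a' du j := fun u hu z =>
    not_mem_Fj_of_not_mem (Finset.disjoint_left.1 hdis hu)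
  refine ⟨fun u hu v hv huv => ?_, fun u hu v hv hne huv => ?_, fun v hv hvb x hx => ?_⟩
  · rw [Wt_apply_of_not_mem_Fj (mk_mem_wireSet_iff.2 ⟨Finset.mem_coe.2 (hD hu), Finset.mem_coe.2 (hD hv), huv.ne⟩) (hfresh u hu v),
      KNLevels.lattW_apply, if_pos ((SimpleGraph.mem_edgeSet G).2 huv)]
  · rw [Wt_apply_of_not_mem_Fj (mk_mem_wireSet_iff.2 ⟨Finset.mem_coe.2 (hD hu), Finset.mem_coe.2 (hD hv), hne⟩) (hfresh u hu v),
      KNLevels.lattW_apply, if_neg (fun h' => huv ((SimpleGraph.mem_edgeSet G).1 h'))]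
  · have hnadj : ¬G.Adj x v := fun hadj => hvb (mem_innerBoundary_iff.2 ⟨hv, x, hx, hadj.symm⟩)
    by_cases hxS : s(x, v) ∈ wireSet (↑(S.Sx G h e a a' du) : Set V)
    · rw [Sym2.eq_swap, Wt_apply_of_not_mem_Fj (by rwa [Sym2.eq_swap]) (hfresh v hv x), KNLevels.lattW_apply,
        if_neg (fun h' => hnadj ((SimpleGraph.mem_edgeSet G).1 h').symm)]
    · exact Wt_apply_of_not_mem_wireSet hxS

/-! ## The weighting of (I1) -/

/-- **`Wpin` is finitely supported on `E_i ∪ E_{w,v} ∪ E_{v,x}`.** [folklore] -/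
theorem finSupp_Wpin (hP : P ⊆ S.Bfr G h e a) : KNLevels.FinSupp (S.Wpin G h e a a' du P) (S.Sx G h e a a' du) := by
  refine ⟨fun x hx => Wpin_apply_of_not_mem_wireSet hP fun hxS => ?_⟩
  obtain ⟨y, hy, hyS⟩ := hx
  exact hyS (Finset.mem_coe.1 (hxS.1 y hy))

/-- **`Wpin` is a subbox weighting on every `Dd ⊆ E_i ∪ E_{w,v} ∪ E_{v,x}` disjoint from `E_i ∪ E_{w,v}`** (valid history: the explored edges are
the edges of `E_i`). [cite: KozmaNitzan2024, §4 p. 31 (D is a subbox of Ω)] -/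
theorem isSubbox_Wpin (hV : S.Valid G h e) (hP : P ⊆ S.Bfr G h e a) {Dd : Finset V} (hD : Dd ⊆ S.Sx G h e a a' du)
    (hdis : Disjoint Dd (S.Vx G h ∪ S.Γ.Ewv a e.1 e.2)) :
    KNLevels.IsSubbox G (S.Wpin G h e a a' du P) S.p Dd := by
  have hF : S.F G h = edgesIn G (S.Vx G h) := hV.F_eq
  refine ⟨fun u hu v hv huv => ?_, fun u hu v hv hne huv => ?_, fun v hv hvb x hx => ?_⟩
  · rw [Wpin_apply_of_not_mem_base hF (Finset.disjoint_left.1 hdis hu)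
      (mk_mem_wireSet_iff.2 ⟨Finset.mem_coe.2 (hD hu), Finset.mem_coe.2 (hD hv), huv.ne⟩),
      KNLevels.lattW_apply, if_pos ((SimpleGraph.mem_edgeSet G).2 huv)]
  · rw [Wpin_apply_of_not_mem_base hF (Finset.disjoint_left.1 hdis hu)
      (mk_mem_wireSet_iff.2 ⟨Finset.mem_coe.2 (hD hu), Finset.mem_coe.2 (hD hv), hne⟩),
      KNLevels.lattW_apply, if_neg (fun h' => huv ((SimpleGraph.mem_edgeSet G).1 h'))]
  · have hnadj : ¬G.Adj x v := fun hadj => hvb (mem_innerBoundary_iff.2 ⟨hv, x, hx, hadj.symm⟩)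
    have _ := hP
    by_cases hxS : s(x, v) ∈ wireSet (↑(S.Sx G h e a a' du) : Set V)
    · rw [Sym2.eq_swap, Wpin_apply_of_not_mem_base hF (Finset.disjoint_left.1 hdis hv) (by rwa [Sym2.eq_swap]), KNLevels.lattW_apply,
        if_neg (fun h' => hnadj ((SimpleGraph.mem_edgeSet G).1 h').symm)]
    · exact Wpin_apply_of_not_mem_wireSet hP hxS

end KSchA

end KNCells

end Transplant

end Summit.CriticalPhenomena.PercolationContinuityZ3.Theorems

end
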